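import Mathlib.Combinatorics.SimpleGraph.Paths
import Mathlib.Combinatorics.SimpleGraph.Walk.Maps
import Mathlib.Order.Interval.Finset.Nat
import Mathlib.Algebra.Group.Embedding
import HarnessLib

/-!
# Cut times and the blob time of a walk

Topic `Literature/Probability/RandomPlanarGeometry` (definition item `defn-BlobTime.cutCount`, for
route SAWCutPointCondensation of the SAW summit, whose items inline the two sub-terms
`((Finset.range p.length).filter fun j => ∀ i ∈ Finset.range (j + 1), ∀ k ∈ Finset.Ioc j p.length,
p.getVert i ≠ p.getVert k).card` and `p.length - (that)` for walks `p` of `zdGraph 2` and of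
`discreteDomainGraph Ω δ`).

For a walk `p = (p₀, p₁, …, p_L)` of a simple graph (`SimpleGraph.Walk`, `pⱼ = p.getVert j`,
`L = p.length`), a time `j < L` is a **cut time** if the past `{p₀, …, pⱼ}` and the future
`{p_{j+1}, …, p_L}` are disjoint — Lawler's one-sided convention (Lawler, *Cut times for simple
random walk*, EJP 1 (1996), paper 13, §1: "An integer `n` is called a cut time for `S` if
`S[0, n] ∩ S[n+1, ∞) = ∅`, where `S[0, n] = {S(j) : 0 ≤ j ≤ n}`"), here for a finite walk. The
**cut count** is the number of cut times and the **blob time** `L - #cut times` is the number of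
steps spent inside loops ("blobs"). The route uses this one-sided cut-TIME count; the two-sided
CUT-POINT count of Gao–Li–Panov–Shiraishi (arXiv:2310.09592, §1: a point `x` visited exactly once
with `γ ∖ {x}` disconnected) differs from it only through local double points at the cut vertex,
and is not defined here.

## Contents (namespace `Literature.Probability.RandomPlanarGeometry.BlobTime`)

* `cutTimes p : Finset ℕ`, `cutCount p = (cutTimes p).card`, `blobTime p = p.length - cutCount p`;
  `cutCount_eq` / `blobTime_eq` restate them as the route's inlined terms.
* (a) `blobTime_eq_zero_iff : blobTime p = 0 ↔ p.IsPath` (every time is a cut time iff `getVert`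
  is injective on `[0, L]`, Mathlib's `IsPath.getVert_injOn_iff`);
* (b) `cutCount_le_length`;
* (c) `cutTimes_append_subset`: a cut time of `p.append q` is a cut time of the piece containing
  it, whence `cutCount_append_le : cutCount (p.append q) ≤ cutCount p + cutCount q` and
  `blobTime_add_le_blobTime_append` (superadditivity of the blob time);
* (d) `cutCount_map` / `blobTime_map`: invariance under `Walk.map f` for an INJECTIVE graph
  homomorphism `f` (in particular graph isomorphisms such as the lattice translations
  `zdShiftIso v` of `zdGraph 2`, `cutCount_map_iso`, and inclusions of spanning subgraphs
  `G ≤ G'` such as `discreteDomainGraph Ω δ ≤ zdGraph 2`, `cutCount_mapLe`).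

Mathlib has walks, paths, `getVert`, `Walk.map`, `IsPath.getVert_injOn_iff`, `getVert_append`,
`getVert_map`, but no cut times / cut points of walks (searched `cutTime`, `cut_time`,
`IsCutVertex`-style names in `Combinatorics/SimpleGraph`). Decidability: the filter predicate is
decided classically (`open scoped Classical in`), exactly as the route's inlined term elaborates
(instance search does not assemble the nested bounded quantifier constructively inside
`Finset.filter`), so `cutCount_eq` / `blobTime_eq` are `rfl`; `cutTimes_eq_filter` transfers to
any other instance.
-/

namespace Literature.Probability.RandomPlanarGeometry

namespace BlobTime

open SimpleGraph Finset

variable {V V' : Type*} {G : SimpleGraph V} {G' : SimpleGraph V'} {u v w : V}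

/-! ### Definitions -/

/-- **The cut times of a walk** `p = (p₀, …, p_L)`: the times `j < L = p.length` such that the
past `{pᵢ : i ≤ j}` and the future `{p_k : j < k ≤ L}` are disjoint (Lawler 1996, §1, one-sided
convention `S[0, n] ∩ S[n+1, L] = ∅`, for a finite walk). The filter predicate is decided
classically, exactly as in the route's inlined term (elaborated under `open scoped Classical`;
instance search does not assemble the nested bounded quantifier constructively inside
`Finset.filter`), so that `cutCount_eq` / `blobTime_eq` below are `rfl`. [cite: Lawler1996CutTimes, §1] -/
noncomputable def cutTimes (p : G.Walk u v) : Finset ℕ :=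
  open scoped Classical in
  (Finset.range p.length).filter fun j =>
    ∀ i ∈ Finset.range (j + 1), ∀ k ∈ Finset.Ioc j p.length, p.getVert i ≠ p.getVert k

/-- **The cut count** `#{cut times}` of a walk (Lawler 1996, §1, the number `∑ Jⱼ` of cut
times along the path). [cite: Lawler1996CutTimes, §1] -/
noncomputable def cutCount (p : G.Walk u v) : ℕ :=
  (cutTimes p).card

/-- **The blob time** of a walk: the number `L - #{cut times}` of steps that are not cut times,
i.e. the time spent inside loops ("blobs") of the walk (route SAWCutPointCondensation; `0` exactly
for self-avoiding walks, `blobTime_eq_zero_iff`). [cite: Lawler1996CutTimes, §1] -/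
noncomputable def blobTime (p : G.Walk u v) : ℕ :=
  p.length - cutCount p

open scoped Classical in
/-- `cutCount` is literally the term inlined in route SAWCutPointCondensation (elaborated, as
there, under `open scoped Classical`). [folklore] -/
theorem cutCount_eq (p : G.Walk u v) :
    cutCount p = ((Finset.range p.length).filter fun j =>
      ∀ i ∈ Finset.range (j + 1), ∀ k ∈ Finset.Ioc j p.length, p.getVert i ≠ p.getVert k).card :=
  rfl

open scoped Classical in
/-- `blobTime` is literally the term inlined in route SAWCutPointCondensation (elaborated, as
there, under `open scoped Classical`). [folklore] -/
theorem blobTime_eq (p : G.Walk u v) :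
    blobTime p = p.length - ((Finset.range p.length).filter fun j =>
      ∀ i ∈ Finset.range (j + 1), ∀ k ∈ Finset.Ioc j p.length, p.getVert i ≠ p.getVert k).card :=
  rfl

/-- Any other decidability instance gives the same cut times (`Decidable` is a subsingleton). [folklore] -/
theorem cutTimes_eq_filter (p : G.Walk u v)
    [DecidablePred fun j => ∀ i ∈ Finset.range (j + 1), ∀ k ∈ Finset.Ioc j p.length,
      p.getVert i ≠ p.getVert k] :
    cutTimes p = (Finset.range p.length).filter fun j =>
      ∀ i ∈ Finset.range (j + 1), ∀ k ∈ Finset.Ioc j p.length, p.getVert i ≠ p.getVert k := by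
  unfold cutTimes
  convert rfl

/-- Membership in `cutTimes`: `j < L` and `pᵢ ≠ p_k` for all `i ≤ j < k ≤ L`. [cite: Lawler1996CutTimes, §1] -/
theorem mem_cutTimes_iff (p : G.Walk u v) (j : ℕ) :
    j ∈ cutTimes p ↔ j < p.length ∧
      ∀ i, i ≤ j → ∀ k, j < k → k ≤ p.length → p.getVert i ≠ p.getVert k := by
  simp only [cutTimes, Finset.mem_filter, Finset.mem_range, Finset.mem_Ioc, Nat.lt_succ_iff, and_imp, ne_eq]

/-- The trivial walk has no cut times. [folklore] -/
@[simp] theorem cutTimes_nil : cutTimes (Walk.nil : G.Walk u u) = ∅ := by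
  simp [cutTimes]

/-- The trivial walk has cut count `0`. [folklore] -/
@[simp] theorem cutCount_nil : cutCount (Walk.nil : G.Walk u u) = 0 := by
  simp [cutCount]

/-- The trivial walk has blob time `0`. [folklore] -/
@[simp] theorem blobTime_nil : blobTime (Walk.nil : G.Walk u u) = 0 := by
  simp [blobTime]

/-! ### (b) Bounds -/

/-- Cut times are times `< L`. [folklore] -/
theorem cutTimes_subset_range (p : G.Walk u v) : cutTimes p ⊆ Finset.range p.length :=
  fun j hj => Finset.mem_range.2 ((mem_cutTimes_iff p j).1 hj).1

/-- **`#{cut times} ≤ L`.** [folklore] -/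
theorem cutCount_le_length (p : G.Walk u v) : cutCount p ≤ p.length := by
  unfold cutCount
  simpa using Finset.card_le_card (cutTimes_subset_range p)

/-- `blobTime + cutCount = length`. [folklore] -/
theorem blobTime_add_cutCount (p : G.Walk u v) : blobTime p + cutCount p = p.length :=
  Nat.sub_add_cancel (cutCount_le_length p)

/-- `blobTime ≤ length`. [folklore] -/
theorem blobTime_le_length (p : G.Walk u v) : blobTime p ≤ p.length :=
  Nat.sub_le _ _

/-! ### (a) Blob time zero characterises self-avoiding walks -/

/-- Every time is a cut time iff `getVert` is injective on `[0, L]`. [folklore] -/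
theorem cutTimes_eq_range_iff (p : G.Walk u v) :
    cutTimes p = Finset.range p.length ↔ Set.InjOn p.getVert {i | i ≤ p.length} := by
  constructor
  · intro h n (hn : n ≤ p.length) m (hm : m ≤ p.length) hnm
    by_contra hne
    rcases lt_or_gt_of_ne hne with hlt | hlt
    · have hc : n ∈ cutTimes p := by rw [h]; exact Finset.mem_range.2 (hlt.trans_le hm)
      exact ((mem_cutTimes_iff p n).1 hc).2 n le_rfl m hlt hm hnm
    · have hc : m ∈ cutTimes p := by rw [h]; exact Finset.mem_range.2 (hlt.trans_le hn)
      exact ((mem_cutTimes_iff p m).1 hc).2 m le_rfl n hlt hn hnm.symm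
  · intro h
    refine Finset.Subset.antisymm (cutTimes_subset_range p) fun j hj => ?_
    rw [Finset.mem_range] at hj
    refine (mem_cutTimes_iff p j).2 ⟨hj, fun i hi k hjk hk heq => ?_⟩
    have hik : i = k := h (show i ≤ p.length by omega) (show k ≤ p.length from hk) heq
    omega

/-- `cutCount = L` iff every time is a cut time. [folklore] -/
theorem cutCount_eq_length_iff (p : G.Walk u v) :
    cutCount p = p.length ↔ cutTimes p = Finset.range p.length := by
  refine ⟨fun h => Finset.eq_of_subset_of_card_le (cutTimes_subset_range p) ?_, fun h => ?_⟩
  · rw [Finset.card_range]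
    exact h.ge
  · rw [cutCount, h, Finset.card_range]

/-- **(a) A walk has blob time `0` iff it is a path (self-avoiding walk)**: every `j < L` is a
cut time iff `i ↦ pᵢ` is injective on `[0, L]` (Mathlib's `IsPath.getVert_injOn_iff`). [folklore] -/
theorem blobTime_eq_zero_iff (p : G.Walk u v) : blobTime p = 0 ↔ p.IsPath := by
  rw [blobTime, Nat.sub_eq_zero_iff_le, ← Walk.IsPath.getVert_injOn_iff, ← cutTimes_eq_range_iff,
    ← cutCount_eq_length_iff]
  exact ⟨fun h => le_antisymm (cutCount_le_length p) h, fun h => h.ge⟩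

/-- A self-avoiding walk has `cutCount = length`. [folklore] -/
theorem cutCount_eq_length_of_isPath {p : G.Walk u v} (hp : p.IsPath) : cutCount p = p.length := by
  have h := (blobTime_eq_zero_iff p).2 hp
  rw [blobTime, Nat.sub_eq_zero_iff_le] at h
  exact le_antisymm (cutCount_le_length p) h

/-! ### (c) Concatenation -/

/-- **A cut time of a concatenation is a cut time of the piece containing it**: the cut times of
`p.append q` lie in `cutTimes p ∪ (cutTimes q + p.length)`. [folklore] -/
theorem cutTimes_append_subset (p : G.Walk u v) (q : G.Walk v w) :
    cutTimes (p.append q) ⊆ cutTimes p ∪ (cutTimes q).map (addRightEmbedding p.length) := by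
  intro j hj
  rw [mem_cutTimes_iff] at hj
  obtain ⟨hjlen, hcut⟩ := hj
  rw [Walk.length_append] at hjlen hcut
  rw [Finset.mem_union, Finset.mem_map]
  by_cases hjp : j < p.length
  · left
    refine (mem_cutTimes_iff p j).2 ⟨hjp, fun i hi k hjk hk heq => ?_⟩
    refine hcut i hi k hjk (by omega) ?_
    rw [Walk.getVert_append, Walk.getVert_append, if_pos (by omega)]
    split_ifs with hk'
    · exact heq
    · have hkl : k = p.length := le_antisymm hk (not_lt.1 hk')
      subst hkl
      rw [heq, Walk.getVert_length, Nat.sub_self, Walk.getVert_zero]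
  · right
    refine ⟨j - p.length, (mem_cutTimes_iff q _).2 ⟨by omega, fun i hi k hjk hk heq => ?_⟩, ?_⟩
    · refine hcut (i + p.length) (by omega) (k + p.length) (by omega) (by omega) ?_
      rw [Walk.getVert_append, Walk.getVert_append, if_neg (by omega), if_neg (by omega),
        Nat.add_sub_cancel, Nat.add_sub_cancel, heq]
    · simp only [addRightEmbedding_apply]
      omega

/-- **(c) Subadditivity of the cut count under concatenation.** [folklore] -/
theorem cutCount_append_le (p : G.Walk u v) (q : G.Walk v w) :
    cutCount (p.append q) ≤ cutCount p + cutCount q := by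
  calc cutCount (p.append q) ≤ (cutTimes p ∪ (cutTimes q).map (addRightEmbedding p.length)).card :=
        Finset.card_le_card (cutTimes_append_subset p q)
    _ ≤ (cutTimes p).card + ((cutTimes q).map (addRightEmbedding p.length)).card :=
        Finset.card_union_le _ _
    _ = cutCount p + cutCount q := by rw [Finset.card_map]; rfl

/-- **(c) Superadditivity of the blob time under concatenation.** [folklore] -/
theorem blobTime_add_le_blobTime_append (p : G.Walk u v) (q : G.Walk v w) :
    blobTime p + blobTime q ≤ blobTime (p.append q) := by
  have h1 := cutCount_append_le p q
  have h2 := cutCount_le_length p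
  have h3 := cutCount_le_length q
  have h4 := cutCount_le_length (p.append q)
  simp only [blobTime, Walk.length_append] at h4 ⊢
  omega

/-! ### (d) Invariance under injective graph homomorphisms -/

/-- The cut times are invariant under `Walk.map f` for an injective graph homomorphism `f`
(`getVert_map`, `length_map`). [folklore] -/
theorem cutTimes_map (f : G →g G') (hf : Function.Injective f) (p : G.Walk u v) :
    cutTimes (p.map f) = cutTimes p := by
  ext j
  simp only [mem_cutTimes_iff, Walk.length_map, Walk.getVert_map, ne_eq, hf.eq_iff]

/-- **(d) The cut count is invariant under `Walk.map` of an injective graph homomorphism** (graph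
isomorphisms such as the lattice translations of `ℤ²`, and inclusions of spanning subgraphs such
as `discreteDomainGraph Ω δ ≤ zdGraph 2`). [folklore] -/
theorem cutCount_map (f : G →g G') (hf : Function.Injective f) (p : G.Walk u v) :
    cutCount (p.map f) = cutCount p := by
  rw [cutCount, cutTimes_map f hf, cutCount]

/-- **(d) The blob time is invariant under `Walk.map` of an injective graph homomorphism.** [folklore] -/
theorem blobTime_map (f : G →g G') (hf : Function.Injective f) (p : G.Walk u v) :
    blobTime (p.map f) = blobTime p := by
  rw [blobTime, cutCount_map f hf, Walk.length_map, blobTime]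

/-- The cut count is invariant under graph isomorphisms (e.g. `zdShiftIso v`, the translation of
`ℤ²` by `v`). [folklore] -/
theorem cutCount_map_iso (e : G ≃g G') (p : G.Walk u v) : cutCount (p.map e.toHom) = cutCount p :=
  cutCount_map e.toHom e.injective p

/-- The blob time is invariant under graph isomorphisms. [folklore] -/
theorem blobTime_map_iso (e : G ≃g G') (p : G.Walk u v) : blobTime (p.map e.toHom) = blobTime p :=
  blobTime_map e.toHom e.injective p

/-- The cut count of a walk of a spanning subgraph `G ≤ H` is the same in `H` (`Walk.mapLe`). [folklore] -/
theorem cutCount_mapLe {H : SimpleGraph V} (h : G ≤ H) (p : G.Walk u v) :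
    cutCount (p.mapLe h) = cutCount p :=
  cutCount_map (Hom.ofLE h) (fun _ _ hxy => hxy) p

/-- The blob time of a walk of a spanning subgraph `G ≤ H` is the same in `H`. [folklore] -/
theorem blobTime_mapLe {H : SimpleGraph V} (h : G ≤ H) (p : G.Walk u v) :
    blobTime (p.mapLe h) = blobTime p :=
  blobTime_map (Hom.ofLE h) (fun _ _ hxy => hxy) p

end BlobTime

end Literature.Probability.RandomPlanarGeometry
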